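import Summits.AtomisticToContinuum.BoseEinsteinCondensation.Theorems.BECConjugateDominationHardCoreExtensionDuhamelSmoothing
import Summits.AtomisticToContinuum.BoseEinsteinCondensation.Theorems.BECConjugateDominationHardCoreExtensionForwardDuhamel
import Summits.AtomisticToContinuum.BoseEinsteinCondensation.Theorems.BECConjugateDominationHardCoreExtensionMildDuhamel
import Summits.AtomisticToContinuum.BoseEinsteinCondensation.Theorems.BECConjugateDominationPositiveMinimiserRegularity
import Literature.MathematicalPhysics.QuantumManyBody.PeriodicGroundStateFeynmanKacProofs
import HarnessLib

/-!
# S6r `stub_periodicGroundStateRegularity` of line `third-law-current-floor` for crux `HardCoreExtension`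
# (stmt-AtomisticToContinuum-11786): `C¹`-regularity of the periodic Feynman–Kac ground state for
# BOUNDED measurable periodised potentials — unconditional

For `N ≥ 1`, `L > 0` and a measurable pair potential `v` with bounded periodisation `v^per ≤ C`, every
witness `Ψ₀` of `IsPeriodicGroundStateFK v L Ψ₀` is `C¹`. Route (the MARKOV route of the c1 lead):
`Ψ₀` is THE Feynman–Kac ground state, continuous and positive (`PeriodicGroundStateFeynmanKac_holds` +
`IsPeriodicGroundStateFK.unique`); the mild Duhamel identity of the Feynman–Kac functional
(`stub_mildDuhamelFK` = Literature `periodicFKSemigroup_duhamel`) gives, by `stub_forwardDuhamelOfMild`,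
the forward identity `duhamel 1 ((W − E₀)Ψ₀) = P_1Ψ₀ − Ψ₀`; `P_1Ψ₀` is `C¹` (`contDiff_one_heatOp`,
continuous bounded data) and the Duhamel term is `C¹` for the bounded MEASURABLE data `(W − E₀)Ψ₀`
(`stub_duhamelSmoothing`). This makes S6' (`stub_boundedPositiveMinimiser`, p92481) unconditional:
positive `C¹` minimisers of the periodic `N`-body energy exist for every bounded repulsive finite-range
potential on every torus. [GilbargTrudinger2001 Thm 8.8 for the classical PDE statement; here no
`W^{2,p}` theory is used.]
-/

noncomputable section

namespace Summit.AtomisticToContinuum.BoseEinsteinCondensation.Cruxes.HardCoreExtension.ThirdLawCurrentFloor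

open MeasureTheory Filter
open scoped ENNReal NNReal Topology
open Literature.MathematicalPhysics.QuantumManyBody.BoseGas
open Summit.AtomisticToContinuum.BoseEinsteinCondensation.Theorems.PositiveMinimiser

/-- The periodic interaction is measurable (local copy of the tree lemma, to keep imports light).
[folklore] -/
private theorem measurable_periodicInteraction_s6r {N : ℕ} {v : ℝ → ℝ≥0∞} (hv : Measurable v)
    (L : ℝ) : Measurable (periodicInteraction (N := N) v L) := by
  unfold periodicInteraction periodizedPotential
  refine Finset.measurable_sum _ fun i _ => Finset.measurable_sum _ fun j _ => ?_
  exact (Measurable.tsum fun n => hv.comp (measurable_id.sub_const _).norm).comp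
    ((measurable_config_apply i).sub (measurable_config_apply j))

/-- **S6r `stub_periodicGroundStateRegularity`** (registered stub of line `third-law-current-floor`,
crux stmt-AtomisticToContinuum-11786; the statement S6' consumes). For `N ≥ 1`, `L > 0` and a
measurable pair potential `v` with bounded periodisation, every witness `Ψ₀` of
`IsPeriodicGroundStateFK v L Ψ₀` is `C¹`: `Ψ₀ = P_1Ψ₀ − duhamel 1 ((W − E₀)Ψ₀)` (mild Duhamel ⇒ forward
Duhamel), `P_1Ψ₀ ∈ C¹` (continuous bounded data), `duhamel 1 ((W − E₀)Ψ₀) ∈ C¹` (bounded measurable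
data). [folklore; GilbargTrudinger2001 Thm 8.8 for the classical statement] -/
theorem stub_periodicGroundStateRegularity :
    ∀ (N : ℕ) (L : ℝ) (v : ℝ → ℝ≥0∞), 1 ≤ N → 0 < L → Measurable v →
      (∃ C : ℝ≥0, ∀ x, periodizedPotential v L x ≤ C) →
      ∀ Ψ₀ : Config N → ℝ, IsPeriodicGroundStateFK v L Ψ₀ → ContDiff ℝ 1 Ψ₀ := by
  intro N L v hN hL hv hC Ψ₀ hGS
  obtain ⟨C, hC'⟩ := hC
  -- `Ψ₀` is THE Feynman–Kac ground state: continuous (and positive)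
  obtain ⟨Φ, hΦ, hcont, -⟩ := PeriodicGroundStateFeynmanKac_holds N L v hN hL hv ⟨C, hC'⟩
  obtain rfl : Ψ₀ = Φ := hGS.unique hΦ
  obtain ⟨M, -, hM⟩ := exists_bound_of_continuous_periodic hL hcont hGS.periodic
  have hMn : ∀ Y, ‖Ψ₀ Y‖ ≤ M := fun Y => by rw [Real.norm_eq_abs]; exact hM Y
  -- the Duhamel weight `w = (W − E₀)Ψ₀` is bounded and measurable
  set w : Config N → ℝ := fun Y => ((periodicInteraction v L Y).toReal -
      (periodicGroundStateEnergy v N L).toReal) * Ψ₀ Y with hw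
  have hwm : Measurable w :=
    (((measurable_periodicInteraction_s6r hv L).ennreal_toReal).sub measurable_const).mul
      hGS.measurable
  have hwb : ∃ M' : ℝ, ∀ Y, ‖w Y‖ ≤ M' := by
    refine ⟨(((N * N : ℕ) : ℝ) * C + |(periodicGroundStateEnergy v N L).toReal|) * M, fun Y => ?_⟩
    rw [hw, Real.norm_eq_abs, abs_mul]
    refine mul_le_mul ?_ (hM Y) (abs_nonneg _) (by positivity)
    refine (abs_sub _ _).trans (add_le_add ?_ le_rfl)
    rw [abs_of_nonneg ENNReal.toReal_nonneg]
    exact toReal_periodicInteraction_le hC' Y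
  -- the identity and the two smooth pieces
  have hid : ∀ X, Ψ₀ X = heatOp (1 : ℝ≥0) Ψ₀ X - duhamel ((1 : ℝ≥0) : ℝ) w X := by
    intro X
    have h := stub_forwardDuhamelOfMild stub_mildDuhamelFK N L v hN hL hv ⟨C, hC'⟩ Ψ₀ hGS X
    rw [NNReal.coe_one, h]
    ring
  have h1 : ContDiff ℝ 1 (heatOp (1 : ℝ≥0) Ψ₀) := contDiff_one_heatOp hcont hMn one_ne_zero
  have h2 : ContDiff ℝ 1 (duhamel ((1 : ℝ≥0) : ℝ) w) := stub_duhamelSmoothing w hwm hwb _ zero_le_one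
  rw [show Ψ₀ = fun X => heatOp (1 : ℝ≥0) Ψ₀ X - duhamel ((1 : ℝ≥0) : ℝ) w X from funext hid]
  exact h1.sub h2

end Summit.AtomisticToContinuum.BoseEinsteinCondensation.Cruxes.HardCoreExtension.ThirdLawCurrentFloor

end
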